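import Literature.MathematicalPhysics.KineticTheory.HardSphereEulerProofs

/-!
# `NearConstantShortTimeHL`: the probability clause is a non-degeneracy clause

Hygiene lemma for the crux `RelayRaceLocality.NearConstantShortTimeHL` (stmt-AtomisticToContinuum-12502) and every
statement over general `(ε_N, n_N)` families of canonical hard-sphere laws
`P N = particleLaw (Φ N) (canonicalDensity 𝕋³ (ε N) (n N) (localGibbsProfile a₀ u₀ θ₀))`, from the standing
disprover's `Cruxes/NearConstantShortTimeHL/Disproof.lean` §3: such a law is EITHER the zero measure OR a probability
measure (`P = Z⁻¹ 1_D f^{⊗n} dZ`; `0⁻¹ = 0`, and the Bochner-junk partition function `Z = 0` in the non-integrable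
case both give the zero measure; otherwise the mass is `Z⁻¹ Z = 1`). Hence the crux's hypothesis
`∀ N, IsProbabilityMeasure (P N)` is exactly `∀ N, P N ≠ 0`: no "finite but unnormalised" junk law exists, and a prover
never needs a separate normalisation argument. refuter-cdisprove-stmt-AtomisticToContinuum-12502-0.
-/

noncomputable section

namespace Summit.AtomisticToContinuum.HydrodynamicLimit.Theorems.NearConstantShortTimeHLNegative

open MeasureTheory Set
open scoped ENNReal
open Literature.MathematicalPhysics.KineticTheory Literature.Analysis.FluidPDE

/-- A canonical hard-sphere law on `𝕋³` with a nonnegative one-particle profile is either the ZERO measure or a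
probability measure. [folklore] -/
theorem particleLaw_canonicalDensity_zero_or_prob {ε : ℝ} {n : ℕ}
    (Φ : HardSphereFlow (Torus.geometry (Fin 3)) ε n) {f₀ : T3 × V3 → ℝ} (hf : ∀ y, 0 ≤ f₀ y) :
    particleLaw Φ (canonicalDensity (Torus.geometry (Fin 3)) ε n f₀) = 0 ∨
      IsProbabilityMeasure (particleLaw Φ (canonicalDensity (Torus.geometry (Fin 3)) ε n f₀)) := by
  set D : Set (Config n (Fin 3) T3) := hardSphereDomain (Torus.geometry (Fin 3)) n ε with hDdef
  have hD : MeasurableSet D := measurableSet_hardSphereDomain _ Torus.measurable_geometry_sepVec n ε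
  set g : Config n (Fin 3) T3 → ℝ := D.indicator (tensorPow n f₀) with hgdef
  have hg0 : ∀ z, 0 ≤ g z := fun z =>
    Set.indicator_nonneg (fun w _ => tensorPow_nonneg (fun y => hf y) n w) z
  set Z : ℝ := canonicalPartition (Torus.geometry (Fin 3)) ε n f₀ with hZdef
  have hZg : Z = ∫ z, g z := rfl
  by_cases hZ : Z = 0
  · left
    rw [particleLaw_eq]
    have h0 : (fun z => ENNReal.ofReal (canonicalDensity (Torus.geometry (Fin 3)) ε n f₀ z)) = 0 := by
      funext z
      simp only [canonicalDensity, Pi.zero_apply]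
      rw [← hZdef, hZ, inv_zero, zero_mul, ENNReal.ofReal_zero]
    rw [h0, withDensity_zero]
  · right
    have hint : Integrable g volume := by
      by_contra h
      exact hZ (hZg.trans (integral_undef h))
    have hZpos : 0 < Z := lt_of_le_of_ne (hZg ▸ integral_nonneg hg0) (Ne.symm hZ)
    refine ⟨?_⟩
    rw [particleLaw_eq, withDensity_apply _ MeasurableSet.univ, Measure.restrict_univ, liouville_eq]
    have h1 : ∀ z, ENNReal.ofReal (canonicalDensity (Torus.geometry (Fin 3)) ε n f₀ z) =
        ENNReal.ofReal Z⁻¹ * ENNReal.ofReal (g z) := by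
      intro z
      rw [canonicalDensity, ← hZdef, ENNReal.ofReal_mul (inv_nonneg.2 hZpos.le)]
    simp_rw [← hDdef, h1]
    rw [lintegral_const_mul' _ _ ENNReal.ofReal_ne_top,
      ← ofReal_integral_eq_lintegral_ofReal hint.restrict (ae_of_all _ hg0)]
    have h2 : ∫ z in D, g z = Z := by
      have e1 : ∫ z in D, g z = ∫ z in D, tensorPow n f₀ z :=
        setIntegral_congr_fun hD fun z hz => by simp only [hgdef, Set.indicator_of_mem hz]
      rw [e1, hZg, hgdef, integral_indicator hD]
    rw [h2, ← ENNReal.ofReal_mul (inv_nonneg.2 hZpos.le), inv_mul_cancel₀ hZ, ENNReal.ofReal_one]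

/-- For the crux's laws the clause `IsProbabilityMeasure (P N)` is EQUIVALENT to `P N ≠ 0`. [folklore] -/
theorem isProbabilityMeasure_particleLaw_iff_ne_zero {ε : ℝ} {n : ℕ}
    (Φ : HardSphereFlow (Torus.geometry (Fin 3)) ε n) {a₀ θ₀ : T3 → ℝ} {u₀ : T3 → V3}
    (ha0 : ∀ x, 0 ≤ a₀ x) (hθ0 : ∀ x, 0 ≤ θ₀ x) :
    IsProbabilityMeasure
        (particleLaw Φ (canonicalDensity (Torus.geometry (Fin 3)) ε n (localGibbsProfile a₀ u₀ θ₀))) ↔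
      particleLaw Φ (canonicalDensity (Torus.geometry (Fin 3)) ε n (localGibbsProfile a₀ u₀ θ₀)) ≠ 0 := by
  constructor
  · intro h h0
    have := h.measure_univ
    rw [h0] at this
    simp at this
  · intro h
    exact (particleLaw_canonicalDensity_zero_or_prob Φ (localGibbsProfile_nonneg ha0 hθ0)).resolve_left h

end Summit.AtomisticToContinuum.HydrodynamicLimit.Theorems.NearConstantShortTimeHLNegative

end
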